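import Literature.Probability.RandomPlanarGeometry.HexParafermionLoop
import HarnessLib

/-!
# The boundary sum of the parafermionic observable in Beaton's ROTATED frame
# (Duminil-Copin–Smirnov's (5) for domains on one side of the column through the start edge)

Topic `Literature/Probability/RandomPlanarGeometry` (continues `HexSAWObservable.lean` — the parafermionic
observable of Duminil-Copin–Smirnov in the tree's coordinate model `HV`: `pwt`, `cv`, `finalDart`, Lemma 1
`vertex_relation` and the summed identity `boundary_sum` under the HALF-PLANE hypothesis `∀ w ∈ V, 0 ≤ w.2.1` — and
`HexParafermionLoop.lean` — the pair cancellation and Lemma 1 re-run under exactly the two uses of that hypothesis,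
`hw : wOut ∉ V` and `h₀ : every simple cycle of V has winding number 0 around the cell (1, 0)`:
`vertex_relation_of_wnd`).  Sources: H. Duminil-Copin, S. Smirnov, *The connective constant of the honeycomb
lattice equals `√(2+√2)`*, Ann. of Math. 175 (2012), Lemma 1 and §3 eq. (5); N. R. Beaton, *The critical surface
fugacity of self-avoiding walks on a rotated honeycomb lattice*, J. Phys. A 47 (2014) 075003 (arXiv:1210.0274),
§2.2, Proposition 4 (arXiv:1210.0274v3 p. 5) and its proof (pp. 5–7): in the rotated domain `D_{T,L}` ("oriented so that it contains
horizontal edges"; walks start at the mid-edge `a` of the bottom horizontal edge `a⁻a⁺`) the adjusted observable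
`F*` "satisfies the same identity (Lemma 3) for all vertices except the two adjacent to `a`", and summing over
`V′(D_{T,L}) = V ∖ {a⁻, a⁺}` gives the five-coefficient boundary identity of Proposition 4.

## What is proved (lane «pcv-sawmu», door D-ROT-1 «HEX-ROT-BOUNDARY-SUM» = face K95.1a of a-idea-1's R95)

* `boundary_sum_of_wnd` — DCS's summed identity (5) in the GENERIC form matching `vertex_relation_of_wnd`
  (hypotheses `wOut ∉ V`, `hvOrigin ∈ V`, no simple cycle of `V` winds around `(1, 0)`); proof = the tree's
  `boundary_sum`, verbatim.
* Beaton's frame: `ξ(x₀, x₁, b) := 2x₀ + x₁ + b` is the coordinate across the vertical edges of the tree's picture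
  (the start edge `{a⁻, a⁺} = {wOut, hvOrigin}` lies on the column `ξ = 0`, the reference cell
  `rightFace wOut hvOrigin = (1, 0)` at `ξ`-position `+1`); **`wnd_eq_zero_of_xi_le`**: a lattice cycle all of whose
  vertices have `ξ ≤ 0` has `wnd · (1, 0) = 0` (the cells `(a, 0)`, `a ≥ 1`, are joined across vertical edges
  whose upper end has `ξ = 2a ≥ 2`; a-idea-1's proof); hence every finite `V` with `V ∖ {O} ⊆ {ξ ≤ −1}` satisfies
  `h₀` (`noWinding_of_xi_le`), and **`boundary_sum_rot`** / `vertex_relation_rot` follow — `boundary_sum_rot` is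
  a-idea-1's face `HV.RotBoundarySum` (Sketch_G15_R95) token for token.  Beaton's Proposition 4 is its instance on
  `V(D_{T,L}) ∖ {a⁻}` once the exits are sorted into the classes `O, I, E, B, P` and their windings read off (not
  done here; cf. `HexSAWLemma2.lean` for the unrotated strips) — generic form; consolidation.

## Contents (namespace `Literature.Probability.RandomPlanarGeometry.SAW.HV`, all PROVED)

`xi`, `xi_wOut`, `xi_hvOrigin`, `xi_adj`, **`wnd_eq_zero_of_xi_le`**, `noWinding_of_xi_le`, **`boundary_sum_of_wnd`**,
**`vertex_relation_rot`**, **`boundary_sum_rot`**.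
-/

noncomputable section

open Finset Literature.Probability.LatticeModels Literature.Probability.Percolation

namespace Literature.Probability.RandomPlanarGeometry.SAW

namespace HV

/-! ### Beaton's height `ξ` and the winding input -/

/-- `ξ(x₀, x₁, b) = 2x₀ + x₁ + b`: the coordinate ACROSS the vertical edges of the tree's picture of `ℍ`
(constant exactly on the vertical edges `{(x₀,x₁,false), (x₀,x₁-1,true)}`, `±1` on the others); Beaton's
rotated-frame height is `-ξ` (progress perpendicular to an edge class). [cite: Beaton2014RotatedHoneycomb, §2 (Fig. 1(b))] -/
def xi (v : HV) : ℤ := 2 * v.1 + v.2.1 + bit v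

/-- `a⁻ = wOut` lies on the column `ξ = 0`. [cite: Beaton2014RotatedHoneycomb, §2.2 (the start edge a⁻a⁺)] -/
theorem xi_wOut : xi wOut = 0 := by simp [xi, wOut]

/-- `a⁺ = hvOrigin` lies on the column `ξ = 0`. [cite: Beaton2014RotatedHoneycomb, §2.2 (the start edge a⁻a⁺)] -/
theorem xi_hvOrigin : xi hvOrigin = 0 := by simp [xi, hvOrigin]

/-- Along an edge `ξ` changes by `0` or `±1` (by `0` exactly on the vertical edges). [cite: Beaton2014RotatedHoneycomb, §2 (Fig. 1(b): the rotated frame)] -/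
theorem xi_adj {u v : HV} (h : hvGraph.Adj u v) :
    xi v = xi u ∨ xi v = xi u + 1 ∨ xi v = xi u - 1 := by
  obtain ⟨a, b, c⟩ := u
  obtain ⟨a', b', c'⟩ := v
  cases c <;> cases c' <;> simp [hvGraph_adj, AdjRel, xi] at h ⊢ <;> omega

/-- **A lattice cycle with all vertices in `{ξ ≤ 0}` does not wind around the cell `(1, 0)`**: the cells
`(a, 0)`, `a ≥ 1`, are pairwise connected across the vertical edges `{(a,-1,true), (a,0,false)}` whose upper
endpoint has `ξ = 2a ≥ 2`, hence is not on the cycle (`wnd_locB` + `flux_eq_zero_of_not_mem`); far to the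
right the winding vanishes (`wnd_eq_zero_of_fst_ne`).  The lattice hypothesis is necessary (for an arbitrary
cyclic list the signed crossing count need not vanish). (Proof: a-idea-1, Sketch_G15_R95.)
[cite: Beaton2014RotatedHoneycomb, §2.2, proof of Proposition 4 (the domain lies on one side of the start edge)] -/
theorem wnd_eq_zero_of_xi_le {l : List HV} (hl : ∀ d ∈ cdarts l, hvGraph.Adj d.1 d.2)
    (hxi : ∀ w ∈ l, xi w ≤ 0) : wnd l (1, 0) = 0 := by
  have step : ∀ a : ℤ, 1 ≤ a → wnd l (a, 0) = wnd l (a + 1, 0) := by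
    intro a ha
    have h := wnd_locB hl a 0
    have h0 : flux l (a, (0 : ℤ) - 1, true) (a, 0, false) = 0 :=
      flux_eq_zero_of_not_mem (Or.inr fun hmem => by
        have := hxi _ hmem; simp only [xi, bit] at this; omega)
    linarith
  have iter : ∀ k : ℕ, wnd l (1, 0) = wnd l (1 + (k : ℤ), 0) := by
    intro k
    induction k with
    | zero => simp
    | succ k ih =>
      rw [ih, step (1 + k) (by omega),
        show (1 : ℤ) + ((k + 1 : ℕ) : ℤ) = 1 + k + 1 by push_cast; ring]
  obtain ⟨K, hK⟩ := exists_fst_le l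
  rw [iter K.toNat]
  exact wnd_eq_zero_of_fst_ne fun w hw => by
    have h1 := hK w hw
    have h2 := Int.self_le_toNat K
    show w.1 ≠ 1 + (K.toNat : ℤ)
    omega

/-- Beaton's rotated domains satisfy the winding hypothesis of `vertex_relation_of_wnd`: if every vertex of `V`
other than `O` has `ξ ≤ -1` (`O` itself has `ξ = 0`), no simple cycle of `V` winds around `(1, 0)`.
[cite: Beaton2014RotatedHoneycomb, §2.2, proof of Proposition 4] -/
theorem noWinding_of_xi_le {V : Finset HV} (hξ : ∀ w ∈ V, w ≠ hvOrigin → xi w ≤ -1) :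
    ∀ c : List HV, (∀ x ∈ c, x ∈ V) → IsCyc c → wnd c (1, 0) = 0 :=
  fun _ hcV hc => wnd_eq_zero_of_xi_le hc.2.2 fun w hw => by
    by_cases h : w = hvOrigin
    · rw [h, xi_hvOrigin]
    · exact (hξ w (hcV w hw) h).trans (by norm_num)

/-! ### The boundary sum, generic and rotated -/

section VertexRelation

variable {V : Finset HV}

/-- **The boundary identity** obtained by summing Lemma 1 over `V` ("values at interior mid-edges
disappear"): the sum over all nontrivial walks ending on a boundary mid-edge (final dart leaving
`V`) of `(direction of the final half-edge) · x_c^ℓ · e^{-iσW}` equals the direction of the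
starting half-edge `a` (the trivial walk, `F(a) = 1`) — GENERIC FORM over the tree's `vertex_relation_of_wnd`
(`HexParafermionLoop.lean`): any finite `V ∌ wOut` containing `O` all of whose simple cycles have winding number
`0` around the cell `(1, 0)`; the tree's `boundary_sum` is the half-plane instance, `boundary_sum_rot` below the
rotated one.  The proof is the tree's, verbatim. [cite: DuminilCopinSmirnov2012, proof of Lemma 2 (eq. (5))] [cite: Beaton2014RotatedHoneycomb, §2.2, Proposition 4 and its proof (arXiv v3 pp. 5–7)] -/
theorem boundary_sum_of_wnd (hw : wOut ∉ V)
    (h₀ : ∀ c : List HV, (∀ x ∈ c, x ∈ V) → IsCyc c → wnd c (1, 0) = 0) (hO : hvOrigin ∈ V) :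
    ∑ P ∈ (midWalks V).filter (fun P => P ≠ [wOut, hvOrigin] ∧ (finalDart P).2 ∉ V),
      edir (finalDart P).1 (finalDart P).2 * pwt P = edir wOut hvOrigin := by
  have h0 : ∑ P ∈ midWalks V, ∑ v ∈ V, cv v P = 0 := by
    rw [sum_comm]; exact sum_eq_zero fun v hv => vertex_relation_of_wnd hw h₀ hv
  have h1 : ∀ P ∈ midWalks V, ∑ v ∈ V, cv v P =
      (if P = [wOut, hvOrigin] then edir hvOrigin wOut else 0) +
      (if P ≠ [wOut, hvOrigin] ∧ (finalDart P).2 ∉ V then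
        edir (finalDart P).1 (finalDart P).2 * pwt P else 0) := by
    intro P hP
    rw [mem_midWalks_iff] at hP
    rw [sum_cv_comm]
    by_cases ht : P = [wOut, hvOrigin]
    · subst ht
      simp [finalDart_trivial, hw, hO, pwt]
    · have h1 : (finalDart P).1 ∈ V := finalDart_fst_mem hP ht
      by_cases h2 : (finalDart P).2 ∈ V
      · simp only [h1, h2, if_true, ht, if_false, not_true_eq_false, and_false, add_zero,
          ne_eq, not_false_eq_true, edir_rev (finalDart P).1 (finalDart P).2, add_neg_cancel,
          zero_mul]
      · simp [h1, h2, ht]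
  rw [sum_congr rfl h1, sum_add_distrib, sum_ite_eq' (midWalks V) [wOut, hvOrigin],
    if_pos (mem_midWalks_iff.2 (isMidWalk_trivial V)), ← sum_filter] at h0
  rw [edir_rev hvOrigin wOut]
  exact eq_neg_of_add_eq_zero_right h0

/-- **Lemma 1 in Beaton's rotated frame**: the vertex relation for every vertex of a finite `V ∌ a⁻` whose
vertices other than `a⁺ = O` lie in `{ξ ≤ -1}`. [cite: Beaton2014RotatedHoneycomb, §2.2, Lemma 3 and proof of Proposition 4] -/
theorem vertex_relation_rot (hw : wOut ∉ V) (hξ : ∀ w ∈ V, w ≠ hvOrigin → xi w ≤ -1) {v : HV} (hvV : v ∈ V) :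
    ∑ P ∈ midWalks V, cv v P = 0 :=
  vertex_relation_of_wnd hw (noWinding_of_xi_le hξ) hvV

/-- **The boundary sum in Beaton's rotated frame** (face K95.1a `HV.RotBoundarySum` of the lane's R95, token for
token): for every finite `V` with `a⁻ = wOut ∉ V`, `a⁺ = hvOrigin ∈ V` and `ξ ≤ -1` on `V ∖ {O}`, the sum over
the nontrivial walks from `a` whose final half-edge leaves `V` of `(direction) · x_c^ℓ · λ^{turning}` equals the
direction of the start edge.  Beaton's Proposition 4 is the instance `V = V(D_{T,L}) ∖ {a⁻}` with the exits
sorted into the classes `O, I, E, B, P` (generic form; the sorting is not done here).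
[cite: Beaton2014RotatedHoneycomb, §2.2, Proposition 4 (arXiv v3 p. 5) and its proof (pp. 5–7: adjusted winding W*, vertex set V′(D_{T,L}) = V ∖ {a⁻, a⁺}); Lemma 3 (local identity)]
[cite: DuminilCopinSmirnov2012, Lemma 2] -/
theorem boundary_sum_rot (hw : wOut ∉ V) (hO : hvOrigin ∈ V) (hξ : ∀ w ∈ V, w ≠ hvOrigin → xi w ≤ -1) :
    ∑ P ∈ (midWalks V).filter (fun P => P ≠ [wOut, hvOrigin] ∧ (finalDart P).2 ∉ V),
      edir (finalDart P).1 (finalDart P).2 * pwt P = edir wOut hvOrigin :=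
  boundary_sum_of_wnd hw (noWinding_of_xi_le hξ) hO

end VertexRelation

end HV

end Literature.Probability.RandomPlanarGeometry.SAW
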